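import Literature.NumberTheory.Sieve.GreenTao2008SharpGYMoebius
import Literature.NumberTheory.Sieve.CoprimeSquarefreeSumsBounds
import HarnessLib

/-!
# The sharp Goldston–Yıldırım sums, II: the diagonalised one-form sum `S₁(q; y, y')`

Trunk T-SIEVE. Second file of the proof of Green–Tao 2008, Proposition 9.8
(`Literature.NumberTheory.Sieve.GreenTao2008.MeasureLinearForms`; B. Green, T. Tao, Ann. of Math.
167 (2008), §§9–10). In the product model of `GreenTao2008SharpGYMoebius` (independent forms) the
main term (10.2) of Proposition 9.5 factorises into `m` one-form sums

  `S₁(q; y, y') = ∑_{(a,q)=(b,q)=1} μ(a) μ(b) gcd(a,b)/(ab) · log₊(y/a) log₊(y'/b)`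

(`q = W` for the main term; `q = W · s` with `s` a product of "coupled" primes for the error terms).
Selberg's diagonalisation `gcd(a,b) = ∑_{e ∣ a, e ∣ b} φ(e)` turns it into

  `S₁(q; y, y') = ∑_{(e,q)=1} μ²(e) φ(e)/e² · M_{qe}(y/e) M_{qe}(y'/e)`     (`diagSum_eq`),

with `M_q` the Möbius sum of file I. This file proves that identity and its two consequences:

* `abs_diagSum_le`: `|S₁(q; y, y')| ≤ B² (q/φ(q))² G_W(y)` for `W ∣ q`, where
  `G_W(x) = ∑_{e ≤ x, (e,W)=1} μ²(e)/φ(e)` (`invTotSum`; the tree's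
  `SquarefreeSums.abs_sum_inv_totient_sub_le` evaluates it as `(φ(W)/W) log x (1 + O(w^{-1/4})) + O_W(1)`);
* the main term `q = W`, `y = y' = R`: `diagSum_main_upper`, `diagSum_main_lower` — two-sided bounds
  for `(φ(W)/W) S₁(W; R, R)/log R` around `1` in terms of `η'` (the accuracy of
  `M_{We}(R/e) = (1 + O(η')) We/φ(We)` for `e ≤ R/Y₀`, from `abs_moebLogCop_sub_le`), the relative
  error `κ = O(w^{-1/4})` and the additive constant of `G_W`, and `(log Y₀ + 1)/log R`; this is the
  sharp-cutoff analogue of "`G₂(0,0) = (W/φ(W))^m`, `I = log R + O(1)`" (Lemma 10.3 / Lemma A.3 of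
  the source) for one form;
* `rankinProd_half_le`: the Rankin factor `Π_n(1/2) ≤ 5^{Z+1} exp(4 log₂ n/√Z)`, which makes `η'`
  explicit uniformly in `e ≤ R` (`abs_ratio_sub_one_le`).

## References

* B. Green, T. Tao, Ann. of Math. (2) 167 (2008), 481–547: §10, (10.2), Lemma 10.3; App. A,
  Lemma A.3. [cite: GreenTaoAnnals2008]
* A. Selberg's diagonalisation of `∑ λ_d λ_e/[d,e]`, e.g. H. Halberstam, H.-E. Richert, *Sieve
  Methods* (1974), Ch. 3. [folklore]
-/

noncomputable section

open Finset Filter Real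
open scoped ArithmeticFunction.Moebius

namespace Literature.NumberTheory.Sieve.GreenTao2008.SharpGY

open Literature.NumberTheory.Sieve.SquarefreeSums (harmErr bConst harmErr_nonneg one_le_bConst
  abs_sum_inv_totient_sub_le)

/-! ### The one-form sum and its diagonalisation -/

/-- **The one-form sum** `S₁(q; y, y') = ∑_{a ≤ y, b ≤ y', (a,q)=(b,q)=1} μ(a)μ(b) gcd(a,b)/(ab) log(y/a) log(y'/b)`
(`gcd(a,b)/(ab) = 1/lcm(a,b)`: the `m = 1` main term of (10.2) in the independent-forms model).
[cite: GreenTaoAnnals2008, Section 10 eq. 10.2] -/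
def diagSum (q : ℕ) (y y' : ℝ) : ℝ :=
  ∑ a ∈ (Icc 1 ⌊y⌋₊).filter (fun a => a.Coprime q), ∑ b ∈ (Icc 1 ⌊y'⌋₊).filter (fun b => b.Coprime q),
    (μ a : ℝ) / a * Real.log (y / a) * ((μ b : ℝ) / b * Real.log (y' / b)) * (Nat.gcd a b : ℝ)

/-- `G_W(x) = ∑_{e ≤ x, e squarefree, (e,W)=1} 1/φ(e)`. [folklore] -/
def invTotSum (W : ℕ) (x : ℝ) : ℝ :=
  ∑ e ∈ (Icc 1 ⌊x⌋₊).filter (fun e => Squarefree e ∧ e.Coprime W), 1 / (e.totient : ℝ)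

/-- `G_W(x) ≥ 0`. [folklore] -/
theorem invTotSum_nonneg (W : ℕ) (x : ℝ) : 0 ≤ invTotSum W x :=
  sum_nonneg fun _ _ => by positivity

/-- `G_W` is monotone in `x`. [folklore] -/
theorem invTotSum_mono (W : ℕ) {x x' : ℝ} (h : x ≤ x') : invTotSum W x ≤ invTotSum W x' := by
  unfold invTotSum
  refine sum_le_sum_of_subset_of_nonneg ?_ fun _ _ _ => by positivity
  intro e he
  rw [mem_filter, mem_Icc] at he ⊢
  exact ⟨⟨he.1.1, he.1.2.trans (Nat.floor_mono h)⟩, he.2⟩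

/-- `G_W` decreases when `W` acquires more prime factors: `W ∣ q ⇒ G_q ≤ G_W`. [folklore] -/
theorem invTotSum_le_of_dvd {W q : ℕ} (h : W ∣ q) (x : ℝ) : invTotSum q x ≤ invTotSum W x := by
  unfold invTotSum
  refine sum_le_sum_of_subset_of_nonneg ?_ fun _ _ _ => by positivity
  intro e he
  rw [mem_filter] at he ⊢
  exact ⟨he.1, he.2.1, he.2.2.coprime_dvd_right h⟩

/-- `gcd(a,b) = ∑_{e ≤ Y, e ∣ a, e ∣ b} φ(e)` for `1 ≤ a ≤ Y` (Gauss). [folklore] -/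
theorem gcd_eq_sum_totient {a b Y : ℕ} (ha : 1 ≤ a) (haY : a ≤ Y) :
    (Nat.gcd a b : ℝ) = ∑ e ∈ (Icc 1 Y).filter (fun e => e ∣ a ∧ e ∣ b), (e.totient : ℝ) := by
  have hg0 : 0 < Nat.gcd a b := Nat.gcd_pos_of_pos_left _ ha
  have hset : (Icc 1 Y).filter (fun e => e ∣ a ∧ e ∣ b) = (Nat.gcd a b).divisors := by
    ext e
    simp only [mem_filter, mem_Icc, Nat.mem_divisors, Nat.dvd_gcd_iff, ne_eq, hg0.ne', not_false_eq_true,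
      and_true]
    constructor
    · exact fun h => h.2
    · intro h
      have he0 : 0 < e := Nat.pos_of_dvd_of_pos h.1 ha
      exact ⟨⟨he0, (Nat.le_of_dvd ha h.1).trans haY⟩, h⟩
  rw [hset, ← Nat.cast_sum, Nat.sum_totient]

/-- `μ(e a) = μ(e) μ(a)` if `(e, a) = 1`, and `= 0` otherwise (`e, a ≥ 1`). [folklore] -/
theorem moebius_mul_eq (e a : ℕ) :
    (μ (e * a) : ℝ) = if a.Coprime e then (μ e : ℝ) * (μ a : ℝ) else 0 := by
  split_ifs with h
  · rw [ArithmeticFunction.isMultiplicative_moebius.map_mul_of_coprime h.symm]; push_cast; ring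
  · have : ¬ Squarefree (e * a) := fun hsq => h (Nat.squarefree_mul_iff.1 hsq).1.symm
    rw [ArithmeticFunction.moebius_eq_zero_of_not_squarefree this]; simp

/-- **The inner reindexing**: for `e ≥ 1`, `q ≥ 1`,
`∑_{a ≤ y, (a,q)=1, e ∣ a} μ(a)/a log(y/a) = 𝟙[(e,q)=1] (μ(e)/e) M_{qe}(y/e)`
(`a = e a'`; `μ(e a') = μ(e)μ(a')` for `(a',e) = 1` and `0` otherwise). [folklore] -/
theorem sum_filter_dvd_eq {q e : ℕ} (hq : q ≠ 0) (he : 1 ≤ e) (y : ℝ) :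
    ∑ a ∈ (Icc 1 ⌊y⌋₊).filter (fun a => a.Coprime q),
        (if e ∣ a then (μ a : ℝ) / a * Real.log (y / a) else 0) =
      if e.Coprime q then (μ e : ℝ) / e * moebLogCop (q * e) (y / e) else 0 := by
  have _hq := hq
  have he0 : e ≠ 0 := by omega
  have he0' : (e : ℝ) ≠ 0 := by exact_mod_cast he0
  rw [← sum_filter]
  by_cases hcop : e.Coprime q
  · rw [if_pos hcop]
    -- Step 1: `a = e a'` with `a'` coprime to `q`
    set T := (Icc 1 (⌊y⌋₊ / e)).filter (fun a' => a'.Coprime q) with hT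
    have hstep1 : ∑ a ∈ ((Icc 1 ⌊y⌋₊).filter (fun a => a.Coprime q)).filter (fun a => e ∣ a),
        (μ a : ℝ) / a * Real.log (y / a) =
        ∑ a' ∈ T, (μ (e * a') : ℝ) / ((e * a' : ℕ) : ℝ) * Real.log (y / ((e * a' : ℕ) : ℝ)) := by
      symm
      refine sum_nbij' (fun a' => e * a') (fun a => a / e) ?_ ?_ ?_ ?_ ?_
      · intro a' ha'
        simp only [hT, mem_filter, mem_Icc] at ha' ⊢
        obtain ⟨⟨ha1, haY⟩, hc⟩ := ha'
        refine ⟨⟨⟨Nat.mul_pos (by omega) (by omega), ?_⟩, ?_⟩, dvd_mul_right e a'⟩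
        · have := (Nat.le_div_iff_mul_le (by omega)).1 haY
          rw [mul_comm]; exact this
        · exact Nat.coprime_mul_iff_left.2 ⟨hcop, hc⟩
      · intro a ha
        simp only [mem_filter, mem_Icc, hT] at ha ⊢
        obtain ⟨⟨⟨ha1, haY⟩, hc⟩, hdvd⟩ := ha
        obtain ⟨k, rfl⟩ := hdvd
        rw [Nat.mul_div_cancel_left k (by omega)]
        have hk : 1 ≤ k := by
          rcases Nat.eq_zero_or_pos k with rfl | hk
          · omega
          · exact hk
        refine ⟨⟨hk, ?_⟩, (Nat.coprime_mul_iff_left.1 hc).2⟩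
        exact (Nat.le_div_iff_mul_le (by omega)).2 (by rw [mul_comm] at haY; exact haY)
      · intro a' _; simp [Nat.mul_div_cancel_left a' (show 0 < e by omega)]
      · intro a ha
        simp only [mem_filter] at ha
        obtain ⟨k, rfl⟩ := ha.2
        rw [Nat.mul_div_cancel_left k (by omega)]
      · intro a' _; rfl
    -- Step 2: `μ(e a') = 𝟙[(a',e)=1] μ(e) μ(a')`, leaving the `a'` coprime to `q e`
    have hstep2 : ∑ a' ∈ T, (μ (e * a') : ℝ) / ((e * a' : ℕ) : ℝ) * Real.log (y / ((e * a' : ℕ) : ℝ)) =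
        ∑ a' ∈ T.filter (fun a' => a'.Coprime e),
          (μ e : ℝ) / e * ((μ a' : ℝ) / a' * Real.log (y / e / a')) := by
      conv_rhs => rw [sum_filter]
      refine sum_congr rfl fun a' ha' => ?_
      have ha0 : a' ≠ 0 := by have := (mem_Icc.1 (mem_filter.1 ha').1).1; omega
      have ha0' : (a' : ℝ) ≠ 0 := by exact_mod_cast ha0
      rw [moebius_mul_eq e a']
      split_ifs with hc
      · push_cast
        rw [div_div]
        field_simp
      · simp
    rw [hstep1, hstep2, ← mul_sum]
    unfold moebLogCop
    rw [Nat.floor_div_natCast]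
    congr 1
    apply sum_congr _ fun _ _ => rfl
    rw [hT, filter_filter]
    refine filter_congr fun a' _ => ?_
    rw [Nat.coprime_mul_iff_right]
  · rw [if_neg hcop]
    refine sum_eq_zero fun a ha => ?_
    simp only [mem_filter] at ha
    exact absurd (Nat.Coprime.coprime_dvd_left ha.2 ha.1.2) hcop

/-- Factoring the `e`-th diagonal term: for a constant `c`,
`∑_a ∑_b [e∣a ∧ e∣b] c f(a) g(b) = c (∑_a [e∣a] f(a)) (∑_b [e∣b] g(b))`. [folklore] -/
theorem sum_sum_ite_dvd_mul (A Bs : Finset ℕ) (e : ℕ) (c : ℝ) (f g : ℕ → ℝ) :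
    ∑ a ∈ A, ∑ b ∈ Bs, (if e ∣ a ∧ e ∣ b then c else 0) * (f a * g b) =
      c * ((∑ a ∈ A, if e ∣ a then f a else 0) * ∑ b ∈ Bs, if e ∣ b then g b else 0) := by
  rw [sum_mul_sum, mul_sum]
  refine sum_congr rfl fun a _ => ?_
  rw [mul_sum]
  refine sum_congr rfl fun b _ => ?_
  by_cases hea : e ∣ a
  · by_cases heb : e ∣ b
    · rw [if_pos ⟨hea, heb⟩, if_pos hea, if_pos heb]
    · simp only [hea, heb, and_false, if_false, zero_mul, mul_zero]
  · simp only [hea, false_and, if_false, zero_mul, mul_zero]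

/-- **Selberg's diagonalisation**:
`S₁(q; y, y') = ∑_{e ≤ y, e squarefree, (e,q)=1} φ(e)/e² · M_{qe}(y/e) · M_{qe}(y'/e)`.
[cite: GreenTaoAnnals2008, Section 10 eq. 10.2] -/
theorem diagSum_eq {q : ℕ} (hq : q ≠ 0) (y y' : ℝ) :
    diagSum q y y' = ∑ e ∈ (Icc 1 ⌊y⌋₊).filter (fun e => Squarefree e ∧ e.Coprime q),
      (e.totient : ℝ) / (e : ℝ) ^ 2 * moebLogCop (q * e) (y / e) * moebLogCop (q * e) (y' / e) := by
  classical
  set A := (Icc 1 ⌊y⌋₊).filter (fun a => a.Coprime q) with hA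
  set Bs := (Icc 1 ⌊y'⌋₊).filter (fun b => b.Coprime q) with hBs
  set E := Icc 1 ⌊y⌋₊ with hE
  set f : ℕ → ℝ := fun a => (μ a : ℝ) / a * Real.log (y / a) with hf
  set g : ℕ → ℝ := fun b => (μ b : ℝ) / b * Real.log (y' / b) with hg
  -- expand `gcd`
  have h1 : diagSum q y y' = ∑ a ∈ A, ∑ b ∈ Bs, ∑ e ∈ E,
      (if e ∣ a ∧ e ∣ b then (e.totient : ℝ) else 0) * (f a * g b) := by
    unfold diagSum
    refine sum_congr rfl fun a ha => sum_congr rfl fun b hb => ?_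
    have ha' := mem_Icc.1 (mem_filter.1 ha).1
    have hb' := mem_Icc.1 (mem_filter.1 hb).1
    rw [gcd_eq_sum_totient ha'.1 ha'.2, sum_filter, ← sum_mul]
    simp only [hf, hg]
    ring
  -- bring `e` outside
  have h2 : ∑ a ∈ A, ∑ b ∈ Bs, ∑ e ∈ E, (if e ∣ a ∧ e ∣ b then (e.totient : ℝ) else 0) * (f a * g b) =
      ∑ e ∈ E, (e.totient : ℝ) * ((∑ a ∈ A, if e ∣ a then f a else 0) * (∑ b ∈ Bs, if e ∣ b then g b else 0)) := by
    rw [sum_congr rfl fun a _ => sum_comm, sum_comm]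
    exact sum_congr rfl fun e _ => sum_sum_ite_dvd_mul A Bs e _ f g
  rw [h1, h2, sum_filter]
  refine sum_congr rfl fun e he' => ?_
  have he1 : 1 ≤ e := (mem_Icc.1 he').1
  have he0 : (e : ℝ) ≠ 0 := by exact_mod_cast (show e ≠ 0 by omega)
  have hfa : (∑ a ∈ A, if e ∣ a then f a else 0) =
      if e.Coprime q then (μ e : ℝ) / e * moebLogCop (q * e) (y / e) else 0 := by
    rw [hA]; exact sum_filter_dvd_eq hq he1 y
  have hgb : (∑ b ∈ Bs, if e ∣ b then g b else 0) =
      if e.Coprime q then (μ e : ℝ) / e * moebLogCop (q * e) (y' / e) else 0 := by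
    rw [hBs]; exact sum_filter_dvd_eq hq he1 y'
  rw [hfa, hgb]
  by_cases hc : e.Coprime q
  · by_cases hsq : Squarefree e
    · rw [if_pos hc, if_pos hc, if_pos ⟨hsq, hc⟩]
      have hμ2 : ((μ e : ℝ)) ^ 2 = 1 := by
        rw [ArithmeticFunction.moebius_apply_of_squarefree hsq]; push_cast
        rw [← pow_mul, mul_comm, pow_mul]; simp
      have : (μ e : ℝ) / e * moebLogCop (q * e) (y / e) * ((μ e : ℝ) / e * moebLogCop (q * e) (y' / e)) =
          (μ e : ℝ) ^ 2 / (e : ℝ) ^ 2 * moebLogCop (q * e) (y / e) * moebLogCop (q * e) (y' / e) := by ring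
      rw [this, hμ2]
      ring
    · rw [if_pos hc, if_pos hc, if_neg (show ¬ (Squarefree e ∧ e.Coprime q) from fun h => hsq h.1)]
      have hμ0 : (μ e : ℝ) = 0 := by exact_mod_cast ArithmeticFunction.moebius_eq_zero_of_not_squarefree hsq
      rw [hμ0]; ring
  · rw [if_neg hc, if_neg hc, if_neg (show ¬ (Squarefree e ∧ e.Coprime q) from fun h => hc h.2)]; ring

/-! ### The crude bound `|S₁| ≤ B² (q/φ(q))² G_W` -/

/-- `q/φ(q) ≥ 1 > 0` for `q ≥ 1`. [folklore] -/
theorem one_le_div_totient {q : ℕ} (hq : q ≠ 0) : 1 ≤ (q : ℝ) / (q.totient : ℝ) := by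
  have hφ : (0 : ℝ) < q.totient := by exact_mod_cast Nat.totient_pos.2 (Nat.pos_of_ne_zero hq)
  rw [le_div_iff₀ hφ, one_mul]
  exact_mod_cast Nat.totient_le q

/-- `(qe)/φ(qe) = (q/φ(q)) (e/φ(e))` for coprime `q, e`. [folklore] -/
theorem div_totient_mul {q e : ℕ} (h : q.Coprime e) :
    ((q * e : ℕ) : ℝ) / ((q * e).totient : ℝ) = (q : ℝ) / (q.totient : ℝ) * ((e : ℝ) / (e.totient : ℝ)) := by
  rw [Nat.totient_mul h]; push_cast
  rw [mul_div_mul_comm]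

/-- **`|S₁(q; y, y')| ≤ B² (q/φ(q))² G_W(y)`** for `W ∣ q`, when `|M| ≤ B`
(termwise: `|M_{qe}| ≤ B qe/φ(qe)`, `φ(e)/e² (e/φ(e))² = 1/φ(e)`, and `(e,q)=1 ⇒ (e,W)=1`).
[cite: GreenTaoAnnals2008, Lemma 10.3] -/
theorem abs_diagSum_le {B : ℝ} (hB : ∀ y, |moebLog y| ≤ B) {W q : ℕ} (hq : q ≠ 0) (hWq : W ∣ q)
    (y y' : ℝ) :
    |diagSum q y y'| ≤ B ^ 2 * ((q : ℝ) / (q.totient : ℝ)) ^ 2 * invTotSum W y := by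
  have hB0 : 0 ≤ B := (abs_nonneg _).trans (hB 0)
  rw [diagSum_eq hq]
  refine (abs_sum_le_sum_abs _ _).trans ?_
  refine le_trans ?_ (mul_le_mul_of_nonneg_left (invTotSum_le_of_dvd hWq y) (by positivity))
  unfold invTotSum
  rw [mul_sum]
  refine sum_le_sum fun e he => ?_
  obtain ⟨he', hsq, hc⟩ := mem_filter.1 he
  have he1 : 1 ≤ e := (mem_Icc.1 he').1
  have he0 : e ≠ 0 := by omega
  have hqe : q * e ≠ 0 := mul_ne_zero hq he0
  have hM1 := abs_moebLogCop_le hB hqe (y / e)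
  have hM2 := abs_moebLogCop_le hB hqe (y' / e)
  rw [div_totient_mul hc.symm] at hM1 hM2
  have hφe : (0 : ℝ) < e.totient := by exact_mod_cast Nat.totient_pos.2 he1
  have he0' : (0 : ℝ) < e := by exact_mod_cast he1
  set Q : ℝ := (q : ℝ) / (q.totient : ℝ)
  set Ee : ℝ := (e : ℝ) / (e.totient : ℝ)
  rw [abs_mul, abs_mul, abs_of_nonneg (by positivity : (0 : ℝ) ≤ (e.totient : ℝ) / (e : ℝ) ^ 2)]
  calc (e.totient : ℝ) / (e : ℝ) ^ 2 * |moebLogCop (q * e) (y / e)| * |moebLogCop (q * e) (y' / e)|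
      ≤ (e.totient : ℝ) / (e : ℝ) ^ 2 * (B * (Q * Ee)) * (B * (Q * Ee)) := by
        gcongr
    _ = B ^ 2 * Q ^ 2 * (1 / (e.totient : ℝ)) := by
        simp only [Ee]
        field_simp

/-! ### The Rankin factor is `exp(o(log R))` -/

/-- `ω(n) log 2 ≤ log n`: `2^{ω(n)} ≤ ∏_{p ∣ n} p ≤ n`. [folklore] -/
theorem card_primeFactors_mul_log_two_le {n : ℕ} (hn : n ≠ 0) :
    (n.primeFactors.card : ℝ) * Real.log 2 ≤ Real.log n := by
  have h1 : 2 ^ n.primeFactors.card ≤ ∏ p ∈ n.primeFactors, p :=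
    Finset.pow_card_le_prod _ _ 2 fun p hp => (Nat.prime_of_mem_primeFactors hp).two_le
  have h2 : ∏ p ∈ n.primeFactors, p ≤ n := Nat.le_of_dvd (Nat.pos_of_ne_zero hn) (Nat.prod_primeFactors_dvd n)
  have h3 : ((2 : ℝ)) ^ n.primeFactors.card ≤ n := by exact_mod_cast h1.trans h2
  have := Real.log_le_log (by positivity) h3
  rwa [Real.log_pow] at this

/-- `(1 - x)⁻¹ ≤ 1 + 4x ≤ exp(4x)` for `0 ≤ x ≤ 3/4`. [folklore] -/
theorem inv_one_sub_le {x : ℝ} (h0 : 0 ≤ x) (h1 : x ≤ 3 / 4) : (1 - x)⁻¹ ≤ 1 + 4 * x := by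
  rw [inv_le_comm₀ (by linarith) (by linarith), le_sub_iff_add_le]
  rw [inv_eq_one_div, div_add' _ _ _ (by linarith), div_le_iff₀ (by linarith)]
  nlinarith

/-- **`Π_n(1/2) ≤ 5^{Z+1} exp(4 ω(n)/√Z)`** for `Z ≥ 1`: primes `≤ Z` contribute at most `5` each,
primes `> Z` at most `exp(4 Z^{-1/2})` each. [folklore] -/
theorem rankinProd_half_le {n : ℕ} {Z : ℕ} (hZ : 1 ≤ Z) :
    rankinProd (1 / 2) n ≤ 5 ^ (Z + 1) * Real.exp (4 * n.primeFactors.card / Real.sqrt Z) := by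
  classical
  unfold rankinProd
  have hfac : ∀ p ∈ n.primeFactors, (1 - (p : ℝ) ^ (-(1 / 2 : ℝ)))⁻¹ ≤ 1 + 4 * (p : ℝ) ^ (-(1 / 2 : ℝ)) := by
    intro p hp
    have hpp := Nat.prime_of_mem_primeFactors hp
    obtain ⟨h0, _⟩ := prime_rpow_neg_lt_one hpp (by norm_num : (0 : ℝ) < 1 / 2)
    refine inv_one_sub_le h0 ?_
    -- `p^{-1/2} ≤ 2^{-1/2} ≤ 3/4`
    have h2 : (p : ℝ) ^ (-(1 / 2 : ℝ)) ≤ (2 : ℝ) ^ (-(1 / 2 : ℝ)) :=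
      Real.rpow_le_rpow_of_nonpos (by norm_num) (by exact_mod_cast hpp.two_le) (by norm_num)
    have h3 : (2 : ℝ) ^ (-(1 / 2 : ℝ)) ≤ 3 / 4 := by
      rw [Real.rpow_neg (by norm_num), ← Real.sqrt_eq_rpow]
      have hs : Real.sqrt 2 * Real.sqrt 2 = 2 := Real.mul_self_sqrt (by norm_num)
      have hs0 : 0 < Real.sqrt 2 := Real.sqrt_pos.2 (by norm_num)
      rw [inv_le_comm₀ hs0 (by norm_num)]
      nlinarith
    exact h2.trans h3
  have hpos : ∀ p ∈ n.primeFactors, 0 ≤ (1 - (p : ℝ) ^ (-(1 / 2 : ℝ)))⁻¹ := fun p hp =>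
    zero_le_one.trans (one_le_rankinFactor (Nat.prime_of_mem_primeFactors hp) (by norm_num))
  refine (prod_le_prod hpos hfac).trans ?_
  rw [← prod_filter_mul_prod_filter_not n.primeFactors (fun p => p ≤ Z)]
  have hZ0 : (0 : ℝ) < Real.sqrt Z := Real.sqrt_pos.2 (by exact_mod_cast hZ)
  refine mul_le_mul ?_ ?_ (prod_nonneg fun p _ => by positivity) (by positivity)
  · -- small primes: at most `Z + 1` of them, each factor `≤ 5`
    have hcard : (n.primeFactors.filter (fun p => p ≤ Z)).card ≤ Z + 1 := by
      calc (n.primeFactors.filter (fun p => p ≤ Z)).card ≤ (range (Z + 1)).card :=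
            card_le_card fun p hp => mem_range.2 (Nat.lt_succ_of_le (mem_filter.1 hp).2)
        _ = Z + 1 := card_range _
    calc ∏ p ∈ n.primeFactors.filter (fun p => p ≤ Z), (1 + 4 * (p : ℝ) ^ (-(1 / 2 : ℝ)))
        ≤ ∏ _p ∈ n.primeFactors.filter (fun p => p ≤ Z), (5 : ℝ) := by
          refine prod_le_prod (fun p _ => by positivity) fun p hp => ?_
          have hpp := Nat.prime_of_mem_primeFactors (mem_filter.1 hp).1
          have := (prime_rpow_neg_lt_one hpp (by norm_num : (0 : ℝ) < 1 / 2)).2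
          linarith
      _ = 5 ^ (n.primeFactors.filter (fun p => p ≤ Z)).card := by rw [prod_const]
      _ ≤ 5 ^ (Z + 1) := pow_le_pow_right₀ (by norm_num) hcard
  · -- large primes: each factor `≤ exp(4/√Z)`
    have hb : ∀ p ∈ n.primeFactors.filter (fun p => ¬ p ≤ Z),
        1 + 4 * (p : ℝ) ^ (-(1 / 2 : ℝ)) ≤ Real.exp (4 / Real.sqrt Z) := by
      intro p hp
      have hpZ : (Z : ℝ) ≤ p := by exact_mod_cast (not_le.1 (mem_filter.1 hp).2).le
      have h1 : (p : ℝ) ^ (-(1 / 2 : ℝ)) ≤ (Z : ℝ) ^ (-(1 / 2 : ℝ)) :=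
        Real.rpow_le_rpow_of_nonpos (by exact_mod_cast hZ) hpZ (by norm_num)
      have h2 : (Z : ℝ) ^ (-(1 / 2 : ℝ)) = (Real.sqrt Z)⁻¹ := by
        rw [Real.rpow_neg (by positivity), Real.sqrt_eq_rpow]
      calc 1 + 4 * (p : ℝ) ^ (-(1 / 2 : ℝ)) ≤ 1 + 4 * (Z : ℝ) ^ (-(1 / 2 : ℝ)) := by linarith
        _ = 1 + 4 / Real.sqrt Z := by rw [h2, div_eq_mul_inv]
        _ ≤ Real.exp (4 / Real.sqrt Z) := by linarith [Real.add_one_le_exp (4 / Real.sqrt Z)]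
    calc ∏ p ∈ n.primeFactors.filter (fun p => ¬ p ≤ Z), (1 + 4 * (p : ℝ) ^ (-(1 / 2 : ℝ)))
        ≤ ∏ _p ∈ n.primeFactors.filter (fun p => ¬ p ≤ Z), Real.exp (4 / Real.sqrt Z) :=
          prod_le_prod (fun p _ => by positivity) hb
      _ = Real.exp (4 / Real.sqrt Z) ^ (n.primeFactors.filter (fun p => ¬ p ≤ Z)).card := by rw [prod_const]
      _ ≤ Real.exp (4 / Real.sqrt Z) ^ n.primeFactors.card :=
          pow_le_pow_right₀ (Real.one_le_exp (by positivity)) (card_le_card (filter_subset _ _))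
      _ = Real.exp (4 * n.primeFactors.card / Real.sqrt Z) := by
          rw [← Real.exp_nat_mul]; congr 1; ring

/-! ### The main term: `S₁(W; R, R) = (1 + o(1)) (W/φ(W)) log R` -/

/-- The index set of the diagonal form: square-free `e ≤ x` coprime to `W`. [folklore] -/
def sqfCop (W : ℕ) (x : ℝ) : Finset ℕ := (Icc 1 ⌊x⌋₊).filter (fun e => Squarefree e ∧ e.Coprime W)

/-- Membership in `sqfCop`. [folklore] -/
theorem mem_sqfCop {W : ℕ} {x : ℝ} {e : ℕ} :
    e ∈ sqfCop W x ↔ (1 ≤ e ∧ e ≤ ⌊x⌋₊) ∧ Squarefree e ∧ e.Coprime W := by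
  unfold sqfCop; rw [mem_filter, mem_Icc]

/-- `G_W(x)` is the sum of `1/φ` over `sqfCop W x`. [folklore] -/
theorem invTotSum_eq (W : ℕ) (x : ℝ) : invTotSum W x = ∑ e ∈ sqfCop W x, 1 / (e.totient : ℝ) := rfl

/-- Cutting `sqfCop W R` at `e Y₀ ≤ R` gives `sqfCop W (R/Y₀)` (`Y₀ ≥ 1`, `R ≥ 0`). [folklore] -/
theorem sqfCop_filter_le {W : ℕ} {R Y₀ : ℝ} (hY1 : 1 ≤ Y₀) (hR : 0 ≤ R) :
    (sqfCop W R).filter (fun e : ℕ => (e : ℝ) * Y₀ ≤ R) = sqfCop W (R / Y₀) := by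
  have hY0 : 0 < Y₀ := by linarith
  ext e
  rw [mem_filter, mem_sqfCop, mem_sqfCop]
  constructor
  · rintro ⟨⟨⟨h1, _⟩, hP⟩, hle⟩
    exact ⟨⟨h1, Nat.le_floor (by rw [le_div_iff₀ hY0]; exact hle)⟩, hP⟩
  · rintro ⟨⟨h1, hle⟩, hP⟩
    have hle' : (e : ℝ) ≤ R / Y₀ := (Nat.cast_le.2 hle).trans (Nat.floor_le (by positivity))
    refine ⟨⟨⟨h1, Nat.le_floor (hle'.trans (div_le_self hR hY1))⟩, hP⟩, ?_⟩
    rwa [le_div_iff₀ hY0] at hle'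

/-- The normalised ratio `ρ_e = (φ(We)/(We)) M_{We}(R/e)` (`≈ 1` for `e ≤ R/Y₀`). [folklore] -/
def rho (W : ℕ) (R : ℝ) (e : ℕ) : ℝ :=
  ((W * e).totient : ℝ) / ((W * e : ℕ) : ℝ) * moebLogCop (W * e) (R / e)

section MainTerm

variable {B η U Y₀ P₀ : ℝ} {W : ℕ} {R : ℝ}

/-- **`ρ_e` is within `η'` of `1`** for `e ≤ R/Y₀`:
`|ρ_e - 1| ≤ η + (B+3) (U/Y₀)^{1/2} P₀` whenever `P₀` bounds the Rankin factor `Π_{We}(1/2)`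
(from `abs_moebLogCop_sub_le` at `q = We`, `y = R/e ≥ Y₀ ≥ U`). [cite: GreenTaoAnnals2008, Lemma 10.3] -/
theorem abs_rho_sub_one_le (hB : ∀ y, |moebLog y| ≤ B) (hU : 1 ≤ U) (hη : 0 ≤ η)
    (hMU : ∀ u : ℝ, U ≤ u → |moebLog u - 1| ≤ η) (hY₀ : U ≤ Y₀) (hW : W ≠ 0) {e : ℕ} (he : e ≠ 0)
    (heR : (e : ℝ) * Y₀ ≤ R) (hP : rankinProd (1 / 2) (W * e) ≤ P₀) :
    |rho W R e - 1| ≤ η + (B + 3) * (U / Y₀) ^ (1 / 2 : ℝ) * P₀ := by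
  have hWe : W * e ≠ 0 := mul_ne_zero hW he
  have he0 : (0 : ℝ) < e := by exact_mod_cast Nat.pos_of_ne_zero he
  have hU0 : 0 < U := by linarith
  have hY0 : 0 < Y₀ := by linarith
  have hRe : Y₀ ≤ R / e := by rw [le_div_iff₀ he0, mul_comm]; exact heR
  have hB0 : 0 ≤ B := (abs_nonneg _).trans (hB 0)
  have hmain := abs_moebLogCop_sub_le hB hU hη hMU hWe (hY₀.trans hRe)
  set Q : ℝ := ((W * e : ℕ) : ℝ) / ((W * e).totient : ℝ) with hQ
  have hQ1 : 1 ≤ Q := one_le_div_totient hWe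
  have hQ0 : 0 < Q := by linarith
  have hinv : ((W * e).totient : ℝ) / ((W * e : ℕ) : ℝ) = Q⁻¹ := by rw [hQ, inv_div]
  have hkey : |rho W R e - 1| = Q⁻¹ * |moebLogCop (W * e) (R / e) - Q| := by
    unfold rho
    rw [hinv, ← abs_of_pos (inv_pos.2 hQ0), ← abs_mul, abs_of_pos (inv_pos.2 hQ0), mul_sub,
      inv_mul_cancel₀ hQ0.ne']
  rw [hkey]
  have hP0 : 0 ≤ rankinProd (1 / 2) (W * e) := zero_le_one.trans (one_le_rankinProd (by norm_num) _)
  have hR0 : 0 < R := lt_of_lt_of_le (by positivity) heR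
  have hratio : (U / (R / e)) ^ (1 / 2 : ℝ) ≤ (U / Y₀) ^ (1 / 2 : ℝ) := by
    refine Real.rpow_le_rpow (by positivity) ?_ (by norm_num)
    exact div_le_div_of_nonneg_left hU0.le hY0 hRe
  have hX0 : 0 ≤ (B + 3) * (U / (R / e)) ^ (1 / 2 : ℝ) * rankinProd (1 / 2) (W * e) := by positivity
  have hX : (B + 3) * (U / (R / e)) ^ (1 / 2 : ℝ) * rankinProd (1 / 2) (W * e) ≤
      (B + 3) * (U / Y₀) ^ (1 / 2 : ℝ) * P₀ := by gcongr
  have hQinv : Q⁻¹ ≤ 1 := inv_le_one_of_one_le₀ hQ1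
  calc Q⁻¹ * |moebLogCop (W * e) (R / e) - Q|
      ≤ Q⁻¹ * (η * Q + (B + 3) * (U / (R / e)) ^ (1 / 2 : ℝ) * rankinProd (1 / 2) (W * e)) :=
        mul_le_mul_of_nonneg_left hmain (inv_pos.2 hQ0).le
    _ = η + Q⁻¹ * ((B + 3) * (U / (R / e)) ^ (1 / 2 : ℝ) * rankinProd (1 / 2) (W * e)) := by
        field_simp
    _ ≤ η + 1 * ((B + 3) * (U / Y₀) ^ (1 / 2 : ℝ) * P₀) := by
        linarith [mul_le_mul hQinv hX hX0 zero_le_one]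
    _ = _ := by ring

/-- `|ρ_e| ≤ B` always (`|M_{We}| ≤ B We/φ(We)`). [cite: GreenTaoAnnals2008, Lemma 10.3] -/
theorem abs_rho_le (hB : ∀ y, |moebLog y| ≤ B) (hW : W ≠ 0) {e : ℕ} (he : e ≠ 0) : |rho W R e| ≤ B := by
  have hWe : W * e ≠ 0 := mul_ne_zero hW he
  have h := abs_moebLogCop_le hB hWe (R / e)
  have hφ0 : (0 : ℝ) < (W * e).totient := by exact_mod_cast Nat.totient_pos.2 (Nat.pos_of_ne_zero hWe)
  have hn0 : (0 : ℝ) < ((W * e : ℕ) : ℝ) := by exact_mod_cast Nat.pos_of_ne_zero hWe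
  unfold rho
  rw [abs_mul, abs_of_pos (by positivity)]
  calc ((W * e).totient : ℝ) / ((W * e : ℕ) : ℝ) * |moebLogCop (W * e) (R / e)|
      ≤ ((W * e).totient : ℝ) / ((W * e : ℕ) : ℝ) * (B * (((W * e : ℕ) : ℝ) / ((W * e).totient : ℝ))) := by
        gcongr
    _ = B := by field_simp

/-- The summand of the diagonal form at `q = W` in terms of `ρ_e`:
`φ(e)/e² M_{We}(R/e)² = (W/φ(W))² ρ_e²/φ(e)` for square-free `e` coprime to `W`. [folklore] -/
theorem diag_term_eq (hW : W ≠ 0) {e : ℕ} (he : e ≠ 0) (hcop : e.Coprime W) :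
    (e.totient : ℝ) / (e : ℝ) ^ 2 * moebLogCop (W * e) (R / e) * moebLogCop (W * e) (R / e) =
      ((W : ℝ) / (W.totient : ℝ)) ^ 2 * (1 / (e.totient : ℝ)) * rho W R e ^ 2 := by
  have hφe : (0 : ℝ) < e.totient := by exact_mod_cast Nat.totient_pos.2 (Nat.pos_of_ne_zero he)
  have hφW : (0 : ℝ) < W.totient := by exact_mod_cast Nat.totient_pos.2 (Nat.pos_of_ne_zero hW)
  have he0 : (0 : ℝ) < e := by exact_mod_cast Nat.pos_of_ne_zero he
  have hW0 : (0 : ℝ) < W := by exact_mod_cast Nat.pos_of_ne_zero hW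
  unfold rho
  rw [Nat.totient_mul hcop.symm]
  push_cast
  field_simp

/-- The diagonal form at `q = W` in terms of `ρ`: `S₁(W;R,R) = (W/φ(W))² ∑_{e ∈ sqfCop W R} ρ_e²/φ(e)`.
[cite: GreenTaoAnnals2008, Section 10 eq. 10.2] -/
theorem diagSum_eq_sum_rho (hW : W ≠ 0) :
    diagSum W R R = ((W : ℝ) / (W.totient : ℝ)) ^ 2 * ∑ e ∈ sqfCop W R, (1 / (e.totient : ℝ)) * rho W R e ^ 2 := by
  rw [diagSum_eq hW, mul_sum]
  refine sum_congr rfl fun e he => ?_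
  obtain ⟨⟨he1, _⟩, _, hc⟩ := mem_sqfCop.1 he
  rw [diag_term_eq hW (by omega) hc]
  ring

variable (hB : ∀ y, |moebLog y| ≤ B) (hW : W ≠ 0)
include hB hW

/-- **Main term, upper bound.** If `|ρ_e - 1| ≤ η'` for `e ≤ R/Y₀` (`Y₀ ≥ 1`, `R ≥ 0`), then
`S₁(W; R, R) ≤ (W/φ(W))² [ (1+η')² G_W(R/Y₀) + B² (G_W(R) - G_W(R/Y₀)) ]`.
[cite: GreenTaoAnnals2008, Lemma 10.3 and Appendix A Lemma A.3] -/
theorem diagSum_main_upper {η' : ℝ} (hY1 : 1 ≤ Y₀) (hR : 0 ≤ R)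
    (hρ : ∀ e : ℕ, e ≠ 0 → e.Coprime W → (e : ℝ) * Y₀ ≤ R → |rho W R e - 1| ≤ η') :
    diagSum W R R ≤ ((W : ℝ) / (W.totient : ℝ)) ^ 2 *
      ((1 + η') ^ 2 * invTotSum W (R / Y₀) + B ^ 2 * (invTotSum W R - invTotSum W (R / Y₀))) := by
  have hB0 : 0 ≤ B := (abs_nonneg _).trans (hB 0)
  rw [diagSum_eq_sum_rho hW]
  refine mul_le_mul_of_nonneg_left ?_ (by positivity)
  have hG2 : invTotSum W R - invTotSum W (R / Y₀) =
      ∑ e ∈ (sqfCop W R).filter (fun e : ℕ => ¬ (e : ℝ) * Y₀ ≤ R), 1 / (e.totient : ℝ) := by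
    rw [invTotSum_eq, invTotSum_eq, ← sqfCop_filter_le hY1 hR,
      ← sum_filter_add_sum_filter_not (sqfCop W R) (fun e : ℕ => (e : ℝ) * Y₀ ≤ R)]
    ring
  rw [hG2, invTotSum_eq, ← sqfCop_filter_le hY1 hR,
    ← sum_filter_add_sum_filter_not (sqfCop W R) (fun e : ℕ => (e : ℝ) * Y₀ ≤ R), mul_sum, mul_sum]
  refine add_le_add (sum_le_sum fun e he => ?_) (sum_le_sum fun e he => ?_)
  · obtain ⟨heS, hle⟩ := mem_filter.1 he
    obtain ⟨⟨he1, _⟩, _, hc⟩ := mem_sqfCop.1 heS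
    have h1 := hρ e (by omega) hc hle
    have h2 : rho W R e ^ 2 ≤ (1 + η') ^ 2 := by
      have : |rho W R e| ≤ 1 + η' := by
        calc |rho W R e| = |(rho W R e - 1) + 1| := by ring_nf
          _ ≤ |rho W R e - 1| + |(1 : ℝ)| := abs_add_le _ _
          _ ≤ 1 + η' := by rw [abs_one]; linarith
      calc rho W R e ^ 2 = |rho W R e| ^ 2 := (sq_abs _).symm
        _ ≤ (1 + η') ^ 2 := pow_le_pow_left₀ (abs_nonneg _) this 2
    calc 1 / (e.totient : ℝ) * rho W R e ^ 2 ≤ 1 / (e.totient : ℝ) * (1 + η') ^ 2 := by gcongr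
      _ = (1 + η') ^ 2 * (1 / (e.totient : ℝ)) := by ring
  · obtain ⟨heS, _⟩ := mem_filter.1 he
    obtain ⟨⟨he1, _⟩, _, _⟩ := mem_sqfCop.1 heS
    have h2 : rho W R e ^ 2 ≤ B ^ 2 := by
      calc rho W R e ^ 2 = |rho W R e| ^ 2 := (sq_abs _).symm
        _ ≤ B ^ 2 := pow_le_pow_left₀ (abs_nonneg _) (abs_rho_le hB hW (by omega)) 2
    calc 1 / (e.totient : ℝ) * rho W R e ^ 2 ≤ 1 / (e.totient : ℝ) * B ^ 2 := by gcongr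
      _ = B ^ 2 * (1 / (e.totient : ℝ)) := by ring

/-- **Main term, lower bound.** Under the same hypotheses with `η' ≤ 1`:
`S₁(W; R, R) ≥ (W/φ(W))² (1-η')² G_W(R/Y₀)` (the terms `e > R/Y₀` are nonnegative squares).
[cite: GreenTaoAnnals2008, Lemma 10.3 and Appendix A Lemma A.3] -/
theorem diagSum_main_lower {η' : ℝ} (hη'1 : η' ≤ 1) (hY1 : 1 ≤ Y₀) (hR : 0 ≤ R)
    (hρ : ∀ e : ℕ, e ≠ 0 → e.Coprime W → (e : ℝ) * Y₀ ≤ R → |rho W R e - 1| ≤ η') :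
    ((W : ℝ) / (W.totient : ℝ)) ^ 2 * ((1 - η') ^ 2 * invTotSum W (R / Y₀)) ≤ diagSum W R R := by
  have _hB0 : 0 ≤ B := (abs_nonneg _).trans (hB 0)
  rw [diagSum_eq_sum_rho hW]
  refine mul_le_mul_of_nonneg_left ?_ (by positivity)
  rw [invTotSum_eq, ← sqfCop_filter_le hY1 hR, mul_sum]
  calc ∑ e ∈ (sqfCop W R).filter (fun e : ℕ => (e : ℝ) * Y₀ ≤ R), (1 - η') ^ 2 * (1 / (e.totient : ℝ))
      ≤ ∑ e ∈ (sqfCop W R).filter (fun e : ℕ => (e : ℝ) * Y₀ ≤ R), 1 / (e.totient : ℝ) * rho W R e ^ 2 := by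
        refine sum_le_sum fun e he => ?_
        obtain ⟨heS, hle⟩ := mem_filter.1 he
        obtain ⟨⟨he1, _⟩, _, hc⟩ := mem_sqfCop.1 heS
        have h1 := hρ e (by omega) hc hle
        have h2 : (1 - η') ^ 2 ≤ rho W R e ^ 2 := by
          have hlow : 1 - η' ≤ rho W R e := by linarith [(abs_le.1 h1).1]
          exact pow_le_pow_left₀ (by linarith) hlow 2
        calc (1 - η') ^ 2 * (1 / (e.totient : ℝ)) = 1 / (e.totient : ℝ) * (1 - η') ^ 2 := by ring
          _ ≤ 1 / (e.totient : ℝ) * rho W R e ^ 2 := by gcongr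
    _ ≤ ∑ e ∈ sqfCop W R, 1 / (e.totient : ℝ) * rho W R e ^ 2 :=
        sum_le_sum_of_subset_of_nonneg (filter_subset _ _) fun e _ _ => by positivity

end MainTerm

/-! ### `G_W` from the tree: two-sided comparison with `(φ(W)/W) log x` -/

/-- **`G_W(x)` two-sided** (the tree's `SquarefreeSums.abs_sum_inv_totient_sub_le` at `⌊x⌋`): for
`x ≥ 1`, every prime `≤ w` dividing `W` (`w ≥ 1`),
`|G_W(x) - (φ(W)/W) log ⌊x⌋| ≤ (harmErr W + 4) bConst 2 + (φ(W)/W) (bConst 2 · w^{-1/4}) log ⌊x⌋`.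
[folklore] -/
theorem abs_invTotSum_sub_le {W : ℕ} (hW : W ≠ 0) {w : ℕ} (hw : 1 ≤ w)
    (hD : ∀ p, p.Prime → p ≤ w → p ∣ W) {x : ℝ} (hx : 1 ≤ x) :
    |invTotSum W x - (W.totient : ℝ) / W * Real.log ⌊x⌋₊| ≤
      (harmErr W + 4) * bConst 2 + (W.totient : ℝ) / W * (bConst 2 * (w : ℝ) ^ (-(1 : ℝ) / 4)) * Real.log ⌊x⌋₊ := by
  have hB : 1 ≤ ⌊x⌋₊ := Nat.le_floor (by simpa using hx)
  exact abs_sum_inv_totient_sub_le hW hw hD hB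

/-- `log ⌊x⌋ ≤ log x` and `log x - 1 ≤ log ⌊x⌋` for `x ≥ 1`. [folklore] -/
theorem log_floor_bounds {x : ℝ} (hx : 1 ≤ x) :
    Real.log ⌊x⌋₊ ≤ Real.log x ∧ Real.log x - 1 ≤ Real.log ⌊x⌋₊ := by
  have hfl1 : (1 : ℝ) ≤ ⌊x⌋₊ := by exact_mod_cast Nat.le_floor (by simpa using hx)
  have hfl : (⌊x⌋₊ : ℝ) ≤ x := Nat.floor_le (by linarith)
  refine ⟨Real.log_le_log (by linarith) hfl, ?_⟩
  -- `x ≤ ⌊x⌋ + 1 ≤ 2 ⌊x⌋ ≤ e ⌊x⌋`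
  have h1 : x ≤ Real.exp 1 * ⌊x⌋₊ := by
    have := Nat.lt_floor_add_one x
    have he : (2 : ℝ) ≤ Real.exp 1 := by linarith [Real.add_one_le_exp (1 : ℝ)]
    nlinarith
  have := Real.log_le_log (by linarith) h1
  rw [Real.log_mul (by positivity) (by linarith), Real.log_exp] at this
  linarith

end Literature.NumberTheory.Sieve.GreenTao2008.SharpGY
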